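import Mathlib
import Literature.RingTheory.MvPolynomial.LinearFormsCoeff
import Summits.ValiantsHypothesis.ValiantsHypothesis.Theorems.RigidityForcesSymmetryRankRigidMinimalReprLaplaceFiveStarWedge
import Summits.ValiantsHypothesis.ValiantsHypothesis.Theorems.RigidityForcesSymmetryRankRigidMinimalReprLaplaceFiveStarWedgePoly
import Summits.ValiantsHypothesis.ValiantsHypothesis.Theorems.RigidityForcesSymmetryRankRigidMinimalReprLaplaceFiveStarT1NormalForm
import Summits.ValiantsHypothesis.ValiantsHypothesis.Theorems.RigidityForcesSymmetryRankRigidMinimalReprLaplaceFiveStarDictionary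

/-!
# ValiantsHypothesis / RigidityForcesSymmetry — crux `LaplaceOptimalFive` (stmt-ValiantsHypothesis-24813), crux idea
`young-shadow` (K1) on the star: **REBASING A T1 TWO-TERM SPLIT TO THE BASIS `(λλᵀ, U'')`**
(memo `NOTE-p4g15-24813-K1-star.md` §4 T1 normal form; memo `NOTE-p4g16-24813-LemmaK-kernel.md` r2 §4 (ii))

✓ `two_term_split` delivers, in its T1 branch, letter tensors `U₁, U₂, W₁, W₂` (symmetric, exchange identity `(C_H)`,
`U₁ ∦ U₂`), a vector `λ` and `s, t` with `sU₁ + tU₂ = λλᵀ`, and `K_i = L·(c_{i1}Q₁ + c_{i2}Q₂)` (`Q_i`, `K_i` the quadric / cubic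
of `U_i` / `W_i`, `L = Σ λ_zX_z`).  This file rewrites the tensor in the basis `(λλᵀ, U₂)` (case `s ≠ 0`; the case `t ≠ 0` is the
same with `1 ↔ 2`) and extracts the T1 NORMAL FORM:

* `two_form_poly` — the polynomial 2-form identity `∂_aQ₁∂_cK₁ − ∂_cQ₁∂_aK₁ + ∂_aQ₂∂_cK₂ − ∂_cQ₂∂_aK₂ = 0` from `(C_H)`
  (✓ `wedge_two_form`, ✓ `eval_pderiv_quadric/cubic`, `MvPolynomial.funext`);
* `sq_linForm_eq_quadric` — `sU₁ + tU₂ = λλᵀ` ⟹ `L² = C s·Q₁ + C t·Q₂`;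
* ★ `t1_rebase` — with `s ≠ 0`: there are `z₀` (`λ_{z₀} ≠ 0`), scalars `a₁, b₁, a₂` with `2b₁ = 3a₂`, and symmetric `W₁', W₂'`
  such that, letter-wise, `U₁⊗W₁ + U₂⊗W₂ = λλᵀ⊗W₁' + U₂⊗W₂'`, `U₁ = s⁻¹λλᵀ − s⁻¹t·U₂`, the cubics of `W₁', W₂'` are
  `k₁ = L(C a₁L² + C b₁Q₂)` and `k₂ = C a₂·L³`, the cubic matrix is `Σ_i U_i(a,b)K_i = λ_aλ_b k₁ + U₂(a,b) k₂` and the quintic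
  is `Q₁K₁ + Q₂K₂ = L²k₁ + Q₂k₂` — exactly the `let`s of ✓ `t1_slack_entry` (with `Q = Q₂`, `q_{ab} = U₂(a,b)`).
  (`b₂ = 0` and `2b₁ = 3a₂` come from ✓ `t1_normal_form`, whose 2-form hypothesis is `two_form_poly` transported to the new basis,
  and whose non-squareness hypothesis is `U₁ ∦ U₂`.)

No definitions, no `sorry`.  Honest framing: (L3) plumbing brick, closes nothing; the `|supp λ| ≤ 2` row lemma and the final
wiring remain; K1-on-the-star PAPER PASS, not kernel; `LaplaceOptimalFive` OPEN · CONTESTED 72/120; `VP ≠ VNP` NOT proved.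
-/

set_option linter.dupNamespace false

namespace Summit.ValiantsHypothesis.ValiantsHypothesis.Theorems.RigidityForcesSymmetryRankRigidMinimalRepr

namespace LaplaceFiveStar

open Finset MvPolynomial

/-- **The polynomial 2-form identity** `Σ_i dQ_i ∧ dK_i = 0` of a closed two-term tensor, from `(C_H)`. [folklore] -/
theorem two_form_poly (U₁ U₂ : Fin 5 → Fin 5 → ℂ) (W₁ W₂ : Fin 5 → Fin 5 → Fin 5 → ℂ)
    (hU1 : ∀ a b : Fin 5, U₁ a b = U₁ b a) (hU2 : ∀ a b : Fin 5, U₂ a b = U₂ b a)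
    (hW1a : ∀ a b c : Fin 5, W₁ a b c = W₁ b a c) (hW1b : ∀ a b c : Fin 5, W₁ a b c = W₁ a c b)
    (hW2a : ∀ a b c : Fin 5, W₂ a b c = W₂ b a c) (hW2b : ∀ a b c : Fin 5, W₂ a b c = W₂ a c b)
    (hC : ∀ A B C D E : Fin 5,
      (U₁ A C * W₁ B D E + U₁ A D * W₁ B C E + U₁ A E * W₁ B C D)
        + (U₂ A C * W₂ B D E + U₂ A D * W₂ B C E + U₂ A E * W₂ B C D)
      = (U₁ B C * W₁ A D E + U₁ B D * W₁ A C E + U₁ B E * W₁ A C D)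
        + (U₂ B C * W₂ A D E + U₂ B D * W₂ A C E + U₂ B E * W₂ A C D))
    (a c : Fin 5) :
    let Q₁ : MvPolynomial (Fin 5) ℂ := ∑ x : Fin 5, ∑ w : Fin 5, C (U₁ x w) * X x * X w
    let Q₂ : MvPolynomial (Fin 5) ℂ := ∑ x : Fin 5, ∑ w : Fin 5, C (U₂ x w) * X x * X w
    let K₁ : MvPolynomial (Fin 5) ℂ := ∑ x : Fin 5, ∑ w : Fin 5, ∑ u : Fin 5, C (W₁ x w u) * X x * X w * X u
    let K₂ : MvPolynomial (Fin 5) ℂ := ∑ x : Fin 5, ∑ w : Fin 5, ∑ u : Fin 5, C (W₂ x w u) * X x * X w * X u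
    pderiv a Q₁ * pderiv c K₁ - pderiv c Q₁ * pderiv a K₁ + pderiv a Q₂ * pderiv c K₂ - pderiv c Q₂ * pderiv a K₂ = 0 := by
  intro Q₁ Q₂ K₁ K₂
  apply MvPolynomial.funext
  intro y
  have prod3 : ∀ (α : Fin 5 → ℂ) (β : Fin 5 → Fin 5 → ℂ),
      (∑ d : Fin 5, α d) * (∑ e : Fin 5, ∑ f : Fin 5, β e f) = ∑ d : Fin 5, ∑ e : Fin 5, ∑ f : Fin 5, α d * β e f := by
    intro α β
    rw [Finset.sum_mul]
    refine Finset.sum_congr rfl fun d _ => ?_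
    rw [Finset.mul_sum]
    refine Finset.sum_congr rfl fun e _ => ?_
    rw [Finset.mul_sum]
  have h := wedge_two_form U₁ U₂ W₁ W₂ hW1b hW2b hC y a c
  simp only [map_sub, map_add, map_mul, map_zero]
  rw [eval_pderiv_quadric U₁ hU1 y a, eval_pderiv_quadric U₁ hU1 y c, eval_pderiv_quadric U₂ hU2 y a,
    eval_pderiv_quadric U₂ hU2 y c, eval_pderiv_cubic W₁ hW1a hW1b y a, eval_pderiv_cubic W₁ hW1a hW1b y c,
    eval_pderiv_cubic W₂ hW2a hW2b y a, eval_pderiv_cubic W₂ hW2a hW2b y c]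
  have e : ∀ (α : Fin 5 → ℂ) (β : Fin 5 → Fin 5 → ℂ),
      (2 * ∑ d : Fin 5, α d) * (3 * ∑ e : Fin 5, ∑ f : Fin 5, β e f)
        = 6 * ∑ d : Fin 5, ∑ e : Fin 5, ∑ f : Fin 5, α d * β e f := by
    intro α β
    rw [← prod3]
    ring
  rw [e, e, e, e]
  have hsum : (∑ d : Fin 5, ∑ e : Fin 5, ∑ f : Fin 5, U₁ a d * y d * (W₁ c e f * y e * y f))
      - (∑ d : Fin 5, ∑ e : Fin 5, ∑ f : Fin 5, U₁ c d * y d * (W₁ a e f * y e * y f))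
      + (∑ d : Fin 5, ∑ e : Fin 5, ∑ f : Fin 5, U₂ a d * y d * (W₂ c e f * y e * y f))
      - (∑ d : Fin 5, ∑ e : Fin 5, ∑ f : Fin 5, U₂ c d * y d * (W₂ a e f * y e * y f))
      = ∑ d : Fin 5, ∑ e : Fin 5, ∑ f : Fin 5, y d * y e * y f *
          ((U₁ a d * W₁ c e f + U₂ a d * W₂ c e f) - (U₁ c d * W₁ a e f + U₂ c d * W₂ a e f)) := by
    simp only [← Finset.sum_sub_distrib, ← Finset.sum_add_distrib]
    exact Finset.sum_congr rfl fun d _ => Finset.sum_congr rfl fun e _ => Finset.sum_congr rfl fun f _ => by ring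
  have : (6 : ℂ) * ((∑ d : Fin 5, ∑ e : Fin 5, ∑ f : Fin 5, U₁ a d * y d * (W₁ c e f * y e * y f))
      - (∑ d : Fin 5, ∑ e : Fin 5, ∑ f : Fin 5, U₁ c d * y d * (W₁ a e f * y e * y f))
      + (∑ d : Fin 5, ∑ e : Fin 5, ∑ f : Fin 5, U₂ a d * y d * (W₂ c e f * y e * y f))
      - (∑ d : Fin 5, ∑ e : Fin 5, ∑ f : Fin 5, U₂ c d * y d * (W₂ a e f * y e * y f))) = 0 := by
    rw [hsum, h, mul_zero]
  linear_combination this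

/-- `sU₁ + tU₂ = λλᵀ` letter-wise ⟹ `L² = C s·Q₁ + C t·Q₂`. [folklore] -/
theorem sq_linForm_eq_quadric (U₁ U₂ : Fin 5 → Fin 5 → ℂ) (lam : Fin 5 → ℂ) (s t : ℂ)
    (hlam : ∀ x w : Fin 5, s * U₁ x w + t * U₂ x w = lam x * lam w) :
    (∑ z : Fin 5, lam z • (X z : MvPolynomial (Fin 5) ℂ)) ^ 2
      = C s * (∑ x : Fin 5, ∑ w : Fin 5, C (U₁ x w) * X x * X w)
        + C t * (∑ x : Fin 5, ∑ w : Fin 5, C (U₂ x w) * X x * X w) := by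
  rw [sq, Finset.sum_mul_sum, Finset.mul_sum, Finset.mul_sum, ← Finset.sum_add_distrib]
  refine Finset.sum_congr rfl fun x _ => ?_
  rw [Finset.mul_sum, Finset.mul_sum, ← Finset.sum_add_distrib]
  refine Finset.sum_congr rfl fun w _ => ?_
  rw [smul_eq_C_mul, smul_eq_C_mul]
  have h := hlam x w
  have hC' : (C (lam x) * C (lam w) : MvPolynomial (Fin 5) ℂ) = C s * C (U₁ x w) + C t * C (U₂ x w) := by
    rw [← map_mul, ← map_mul, ← map_mul, ← map_add, ← h]
  linear_combination (X x * X w : MvPolynomial (Fin 5) ℂ) * hC'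

/-- **Rebasing a T1 two-term split** (case `s ≠ 0`) to the basis `(λλᵀ, U₂)`, with the T1 normal form `k₁ = L(a₁L² + b₁Q₂)`,
`k₂ = a₂L³`, `2b₁ = 3a₂` read off ✓ `t1_normal_form`. [folklore] -/
theorem t1_rebase (U₁ U₂ : Fin 5 → Fin 5 → ℂ) (W₁ W₂ : Fin 5 → Fin 5 → Fin 5 → ℂ)
    (hU1 : ∀ a b : Fin 5, U₁ a b = U₁ b a) (hU2 : ∀ a b : Fin 5, U₂ a b = U₂ b a)
    (hW1a : ∀ a b c : Fin 5, W₁ a b c = W₁ b a c) (hW1b : ∀ a b c : Fin 5, W₁ a b c = W₁ a c b)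
    (hW2a : ∀ a b c : Fin 5, W₂ a b c = W₂ b a c) (hW2b : ∀ a b c : Fin 5, W₂ a b c = W₂ a c b)
    (hC : ∀ A B C D E : Fin 5,
      (U₁ A C * W₁ B D E + U₁ A D * W₁ B C E + U₁ A E * W₁ B C D)
        + (U₂ A C * W₂ B D E + U₂ A D * W₂ B C E + U₂ A E * W₂ B C D)
      = (U₁ B C * W₁ A D E + U₁ B D * W₁ A C E + U₁ B E * W₁ A C D)
        + (U₂ B C * W₂ A D E + U₂ B D * W₂ A C E + U₂ B E * W₂ A C D))
    (hind : ∀ s t : ℂ, (∀ x w : Fin 5, s * U₁ x w + t * U₂ x w = 0) → s = 0 ∧ t = 0)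
    (lam : Fin 5 → ℂ) (s t : ℂ) (hs : s ≠ 0) (hlam : ∀ x w : Fin 5, s * U₁ x w + t * U₂ x w = lam x * lam w)
    (c₁₁ c₁₂ c₂₁ c₂₂ : ℂ)
    (hK₁ : (∑ x : Fin 5, ∑ w : Fin 5, ∑ u : Fin 5, C (W₁ x w u) * X x * X w * X u : MvPolynomial (Fin 5) ℂ)
      = (∑ z : Fin 5, lam z • (X z : MvPolynomial (Fin 5) ℂ)) *
        (C c₁₁ * (∑ x : Fin 5, ∑ w : Fin 5, C (U₁ x w) * X x * X w)
          + C c₁₂ * (∑ x : Fin 5, ∑ w : Fin 5, C (U₂ x w) * X x * X w)))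
    (hK₂ : (∑ x : Fin 5, ∑ w : Fin 5, ∑ u : Fin 5, C (W₂ x w u) * X x * X w * X u : MvPolynomial (Fin 5) ℂ)
      = (∑ z : Fin 5, lam z • (X z : MvPolynomial (Fin 5) ℂ)) *
        (C c₂₁ * (∑ x : Fin 5, ∑ w : Fin 5, C (U₁ x w) * X x * X w)
          + C c₂₂ * (∑ x : Fin 5, ∑ w : Fin 5, C (U₂ x w) * X x * X w))) :
    let L : MvPolynomial (Fin 5) ℂ := ∑ z : Fin 5, lam z • (X z : MvPolynomial (Fin 5) ℂ)
    let Q₁ : MvPolynomial (Fin 5) ℂ := ∑ x : Fin 5, ∑ w : Fin 5, C (U₁ x w) * X x * X w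
    let Q₂ : MvPolynomial (Fin 5) ℂ := ∑ x : Fin 5, ∑ w : Fin 5, C (U₂ x w) * X x * X w
    let K₁ : MvPolynomial (Fin 5) ℂ := ∑ x : Fin 5, ∑ w : Fin 5, ∑ u : Fin 5, C (W₁ x w u) * X x * X w * X u
    let K₂ : MvPolynomial (Fin 5) ℂ := ∑ x : Fin 5, ∑ w : Fin 5, ∑ u : Fin 5, C (W₂ x w u) * X x * X w * X u
    ∃ (z₀ : Fin 5) (a₁ b₁ a₂ : ℂ) (W₁' W₂' : Fin 5 → Fin 5 → Fin 5 → ℂ),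
      lam z₀ ≠ 0 ∧ 2 * b₁ = 3 * a₂ ∧
      (∀ x w u : Fin 5, W₁' x w u = W₁' w x u) ∧ (∀ x w u : Fin 5, W₁' x w u = W₁' x u w) ∧
      (∀ x w u : Fin 5, W₂' x w u = W₂' w x u) ∧ (∀ x w u : Fin 5, W₂' x w u = W₂' x u w) ∧
      (∀ x y z w u : Fin 5, U₁ x y * W₁ z w u + U₂ x y * W₂ z w u = lam x * lam y * W₁' z w u + U₂ x y * W₂' z w u) ∧
      (∀ x w : Fin 5, U₁ x w = s⁻¹ * (lam x * lam w) - s⁻¹ * t * U₂ x w) ∧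
      (∑ x : Fin 5, ∑ w : Fin 5, ∑ u : Fin 5, C (W₁' x w u) * X x * X w * X u : MvPolynomial (Fin 5) ℂ)
        = L * (C a₁ * L ^ 2 + C b₁ * Q₂) ∧
      (∑ x : Fin 5, ∑ w : Fin 5, ∑ u : Fin 5, C (W₂' x w u) * X x * X w * X u : MvPolynomial (Fin 5) ℂ)
        = C a₂ * L ^ 3 ∧
      (∀ a b : Fin 5, C (U₁ a b) * K₁ + C (U₂ a b) * K₂
        = C (lam a * lam b) * (L * (C a₁ * L ^ 2 + C b₁ * Q₂)) + C (U₂ a b) * (C a₂ * L ^ 3)) ∧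
      Q₁ * K₁ + Q₂ * K₂ = L ^ 2 * (L * (C a₁ * L ^ 2 + C b₁ * Q₂)) + Q₂ * (C a₂ * L ^ 3) := by
  intro L Q₁ Q₂ K₁ K₂
  -- a non-zero coordinate of λ
  have hz : ∃ z₀ : Fin 5, lam z₀ ≠ 0 := by
    by_contra h0
    simp only [not_exists, not_not] at h0
    have h := hind s t fun x w => by rw [hlam, h0 x, zero_mul]
    exact hs h.1
  obtain ⟨z₀, hz₀⟩ := hz
  -- scalars of the new basis
  set a₁ : ℂ := c₁₁ / s ^ 2 with ha₁
  set b₁ : ℂ := c₁₂ / s - a₁ * t with hb₁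
  set a₂ : ℂ := c₂₁ / s - t * a₁ with ha₂
  set b₂ : ℂ := c₂₂ - t * (a₁ * t + b₁) - a₂ * t with hb₂
  have i1 : s * a₁ * s = c₁₁ := by rw [ha₁]; field_simp
  have i2 : s * a₁ * t + s * b₁ = c₁₂ := by rw [hb₁]; field_simp; ring
  have i3 : a₂ * s = c₂₁ - t * a₁ * s := by rw [ha₂]; field_simp
  have i4 : a₂ * t + b₂ = c₂₂ - t * (a₁ * t + b₁) := by rw [hb₂]; ring
  -- polynomial identities
  have hL2 : L ^ 2 = C s * Q₁ + C t * Q₂ := sq_linForm_eq_quadric U₁ U₂ lam s t hlam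
  have hK₁' : K₁ = L * (C c₁₁ * Q₁ + C c₁₂ * Q₂) := hK₁
  have hK₂' : K₂ = L * (C c₂₁ * Q₁ + C c₂₂ * Q₂) := hK₂
  have hss : s * s⁻¹ = 1 := mul_inv_cancel₀ hs
  set k₁ : MvPolynomial (Fin 5) ℂ := L * (C a₁ * L ^ 2 + C b₁ * Q₂) with hk₁
  set k₂ : MvPolynomial (Fin 5) ℂ := L * (C a₂ * L ^ 2 + C b₂ * Q₂) with hk₂
  have hK1k : K₁ = C s * k₁ := by
    have e1 : C s * C a₁ * C s = (C c₁₁ : MvPolynomial (Fin 5) ℂ) := by rw [← map_mul, ← map_mul, i1]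
    have e2 : C s * C a₁ * C t + C s * C b₁ = (C c₁₂ : MvPolynomial (Fin 5) ℂ) := by
      rw [← map_mul, ← map_mul, ← map_mul, ← map_add, i2]
    rw [hK₁', hk₁, hL2]
    linear_combination (-(L * Q₁)) * e1 + (-(L * Q₂)) * e2
  have hK2k : K₂ = k₂ + C t * k₁ := by
    have e3 : C a₂ * C s = (C c₂₁ - C t * C a₁ * C s : MvPolynomial (Fin 5) ℂ) := by
      rw [← map_mul, ← map_mul, ← map_mul, ← map_sub, i3]
    have e4 : C a₂ * C t + C b₂ = (C c₂₂ - C t * (C a₁ * C t + C b₁) : MvPolynomial (Fin 5) ℂ) := by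
      rw [← map_mul, ← map_mul, ← map_add, ← map_add, ← map_mul, ← map_sub, i4]
    rw [hK₂', hk₁, hk₂, hL2]
    linear_combination (-(L * Q₁)) * e3 + (-(L * Q₂)) * e4
  -- the 2-form identity in the new basis, and the T1 normal form
  have hnsq : ∀ c : ℂ, ¬ ∀ x w : Fin 5, U₂ x w = c * (lam x * lam w) := by
    intro c h
    have h2 := hind (c * s) (c * t - 1) fun x w => by
      have := hlam x w
      have := h x w
      linear_combination c * hlam x w - h x w
    have hc : c ≠ 0 := by
      intro hc
      have := h2.2
      rw [hc, zero_mul, zero_sub] at this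
      exact one_ne_zero (neg_eq_zero.mp this)
    exact hs ((mul_eq_zero.mp h2.1).resolve_left hc)
  have hw : ∀ a c : Fin 5,
      pderiv a (L ^ 2) * pderiv c k₁ - pderiv c (L ^ 2) * pderiv a k₁
        + pderiv a Q₂ * pderiv c k₂ - pderiv c Q₂ * pderiv a k₂ = 0 := by
    intro a c
    have h0 := two_form_poly U₁ U₂ W₁ W₂ hU1 hU2 hW1a hW1b hW2a hW2b hC a c
    simp only at h0
    change pderiv a Q₁ * pderiv c K₁ - pderiv c Q₁ * pderiv a K₁ + pderiv a Q₂ * pderiv c K₂ - pderiv c Q₂ * pderiv a K₂ = 0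
      at h0
    rw [hK1k, hK2k] at h0
    simp only [map_add, pderiv_C_mul] at h0
    rw [hL2]
    simp only [map_add, pderiv_C_mul]
    linear_combination h0
  obtain ⟨hb₂0, hrel⟩ := t1_normal_form lam z₀ hz₀ U₂ hU2 hnsq Q₂ rfl a₁ b₁ a₂ b₂ hw
  have hk₂' : k₂ = C a₂ * L ^ 3 := by rw [hk₂, hb₂0, C_0, zero_mul, add_zero]; ring
  -- the new long factors
  refine ⟨z₀, a₁, b₁, a₂, fun x w u => s⁻¹ * W₁ x w u, fun x w u => W₂ x w u - s⁻¹ * t * W₁ x w u, hz₀, hrel,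
    fun x w u => by dsimp only; rw [hW1a], fun x w u => by dsimp only; rw [hW1b],
    fun x w u => by dsimp only; rw [hW2a, hW1a], fun x w u => by dsimp only; rw [hW2b, hW1b],
    fun x y z w u => ?_, fun x w => ?_, ?_, ?_, fun a b => ?_, ?_⟩
  · have h := hlam x y
    dsimp only
    linear_combination (s⁻¹ * W₁ z w u) * h - (U₁ x y * W₁ z w u) * hss
  · have h := hlam x w
    linear_combination s⁻¹ * h - (U₁ x w) * hss
  · -- cubic of `W₁' = s⁻¹W₁` is `s⁻¹K₁ = k₁`
    have h1 : (∑ x : Fin 5, ∑ w : Fin 5, ∑ u : Fin 5, C (s⁻¹ * W₁ x w u) * X x * X w * X u : MvPolynomial (Fin 5) ℂ)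
        = C s⁻¹ * K₁ := cubicSum_smul W₁ s⁻¹
    rw [h1, hK1k, ← mul_assoc, ← map_mul, inv_mul_cancel₀ hs, C_1, one_mul]
  · have h1 : (∑ x : Fin 5, ∑ w : Fin 5, ∑ u : Fin 5, C (W₂ x w u - s⁻¹ * t * W₁ x w u) * X x * X w * X u
          : MvPolynomial (Fin 5) ℂ) = K₂ + C (-(s⁻¹ * t)) * K₁ := by
      rw [← cubicSum_smul W₁, ← cubicSum_add]
      intro x w u
      ring
    have e : C (-(s⁻¹ * t)) * C s = -(C t : MvPolynomial (Fin 5) ℂ) := by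
      rw [← map_mul, show -(s⁻¹ * t) * s = -t by field_simp, map_neg]
    rw [h1, hK2k, hK1k, hk₂']
    linear_combination k₁ * e
  · have hU1ab : (C (U₁ a b) : MvPolynomial (Fin 5) ℂ) = C s⁻¹ * (C (lam a * lam b) - C t * C (U₂ a b)) := by
      rw [← map_mul, ← map_sub, ← map_mul, ← hlam a b]
      congr 1
      field_simp
      ring
    have hsinv : C s⁻¹ * C s = (1 : MvPolynomial (Fin 5) ℂ) := by rw [← map_mul, inv_mul_cancel₀ hs, C_1]
    rw [hU1ab, hK1k, hK2k, hk₂']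
    linear_combination ((C (lam a * lam b) - C t * C (U₂ a b)) * k₁) * hsinv
  · rw [hK1k, hK2k, hk₂']
    show Q₁ * (C s * k₁) + Q₂ * (C a₂ * L ^ 3 + C t * k₁) = L ^ 2 * k₁ + Q₂ * (C a₂ * L ^ 3)
    rw [hL2]
    ring
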